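import Literature.IUT.HodgeTheaters.BadLocalFrobenioidOfKitsTempered
import Literature.AlgebraicGeometry.Frobenioids.Thm34SubClosers2
import Literature.AnabelianGeometry.SemiGraphs.CosetCategoriesSlimTempered
import HarnessLib

/-!
# [IUTchI] Example 3.2 (vi) (d) at `ofKits` over an [EtTh] tempered Frobenioid: "`D_v` may be reconstructed
# category-theoretically either from `F̲_v` … or from `C_v`" — from [FrdI] Thm. 3.4 (v), modulo its printed hypotheses
# on `F̲_v`, `C_v` and the slimness of `Π^tp_v` (proof-only)

Mochizuki, *Inter-universal Teichmüller Theory I*, kurims manuscript (May 2020), Example 3.2 (vi) (d) p. 73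
[cite: Mochizuki2012, I Ex 3.2 (vi) p.73]: "(d) the category `D_v` may be reconstructed category-theoretically either
from `F̲_v` [cf. [EtTh], Theorem 4.4; [EtTh], Proposition 5.1] or from `C_v` [cf. [FrdI], Theorem 3.4, (v); [FrdII],
Theorem 1.2, (i); [FrdII], Example 1.3, (i); [SemiAnbd], Example 3.10; [SemiAnbd], Remark 3.4.1]" (D-0012 claim key,
status disputed; nothing of the series is asserted; typed ≠ proved — abc-iut-L5-t2 typed (d) as the model-relative
`Prop` `BadLocalFrobenioid.DFromF`, a schema (abc-iut-w4-d047's halving model), discharged here AT AN INSTANCE).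

PROOF-ONLY (0 definitions). At the instance `BadLocalFrobenioid.ofKits … R.toInput` of `BadLocalFrobenioidOfKitsTempered.lean`
(`F̲_v := C.category` an [EtTh] Def. 3.6 tempered Frobenioid over the REAL base `D_v = CosetCat Π_v`, `C_v := C^{bs-fld}`):
* `modelFrobenioid_base_reconstructible` — the [FrdI] Thm. 3.4 (v) extraction for ANY model Frobenioid (abc-iut-L1's
  `FrdI.Thm34Sub.thm34v_FSM_holds`: under the hypothesis bundle `StdHyp` — (a) standard type, (b), Frobenioid over an
  FSM-type base — and a slim base, a self-equivalence descends to a `1`-unique self-equivalence of the base), the pattern of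
  abc-iut-w4-d047's `GoodLocalFrobenioid.padicFrobenioid_base_reconstructible` [cite: MochizukiFrdII2008, Thm 1.2 (i) p.9];
* **`dFromF_ofKits_toInput`** — (d) HOLDS at the instance, BOTH halves (from `F̲_v` and from `C_v`), modulo: `StdHyp` for the
  self-equivalences of `F̲_v` (resp. of `C_v`) — the printed inputs "[FrdI] Thm. 3.4 (v); [FrdII] Thm. 1.2 (i)" as
  hypotheses on the [EtTh] tempered Frobenioid and its hull — and `IsSlim (CosetCat Π_v)`;
* **`dFromF_ofKits_toInput_of_isTempered`** — the slimness input in the PRINTED group form "[SemiAnbd] Ex. 3.10, Rmk. 3.4.1":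
  `Π_v` TEMPERED and slim ⇒ `𝓑^temp(Π_v)⁰` slim (abc-iut-L3's `CosetCat.isSlim_of_isSlimGroup_of_isTempered`)
  [cite: MochizukiSemiAnbd2006, Rmk 3.4.1 p.36].
-/

-- `(PreFrobenioidData.ofFunctor Φ F).base` is `ModelFrobenioid.baseFunctor` only at default transparency (as in
-- abc-iut-w4-d047's `GoodLocalFrobenioidOfKitBases.lean`).
set_option backward.isDefEq.respectTransparency false

noncomputable section

namespace Literature.IUT.HodgeTheaters

open CategoryTheory Opposite Literature.AnabelianGeometry.SemiGraphs Literature.AlgebraicGeometry.Frobenioids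
open Literature.AlgebraicGeometry.Frobenioids.PadicFrd Literature.AnabelianGeometry.EtaleTheta

namespace BadLocalFrobenioid

/-! ### [FrdI] Thm. 3.4 (v): the base of a model Frobenioid is reconstructible -/

section Generic

universe w v u

variable {D : Type u} [Category.{v} D] {Φ B : Dᵒᵖ ⥤ CommMonCat.{w}} {divB : B ⟶ monoidGp Φ}

/-- **The base of a model Frobenioid is reconstructible category-theoretically** ([FrdI] Thm. 3.4 (v) via abc-iut-L1's
`thm34v_FSM_holds`): under `StdHyp` for the self-equivalence `e` of `C = ModelFrobenioid Φ B Div_B` and a slim base `D`,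
there is a self-equivalence `e'` of `D` with `(C → D) ⋙ e' ≅ e ⋙ (C → D)`. [cite: MochizukiFrdII2008, Thm 1.2 (i) p.9] -/
theorem modelFrobenioid_base_reconstructible (e : ModelFrobenioid Φ B divB ≌ ModelFrobenioid Φ B divB)
    (h : FrdI.Thm34Sub.StdHyp (ModelFrobenioid.toElem Φ B divB) (ModelFrobenioid.toElem Φ B divB) e)
    (hslim : IsSlim D) :
    ∃ e' : D ≌ D, Nonempty (ModelFrobenioid.baseFunctor Φ B divB ⋙ e'.functor ≅
      e.functor ⋙ ModelFrobenioid.baseFunctor Φ B divB) := by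
  obtain ⟨ΨBase, ⟨hEq, ⟨I⟩, -⟩, -, -⟩ := (FrdI.Thm34Sub.thm34v_FSM_holds _ _ e h hslim hslim).2.2
  haveI := hEq
  exact ⟨ΨBase.asEquivalence, ⟨I.symm⟩⟩

end Generic

/-! ### Example 3.2 (vi) (d) at `ofKits … R.toInput` -/

universe u₀ v₀

variable {p : ℕ} [Fact p.Prime] (l : ℕ) (d : GaloisValDatum.{0} p) {P : Type} [Group P] [TopologicalSpace P]
  (T : BadLocalGroupDatum d.Gal P) (q qroot : intNonzero d.k) (hpow : qroot ^ (2 * l) = q) (hq : ¬ IsUnit qroot)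
  {D₀ : Type u₀} [Category.{v₀} D₀] {V : FrdIMonoidStub.{0}} {T' : RealifiedDivisorMonoids (D₀ := D₀) V}
  {VD : FrdICatStub.{0, 0, 0} T.Dv} (C : TemperedFrobenioid T' T.Dv VD) {Fbirat : Type} [Category.{0} Fbirat]
  (R : TemperedThetaRest d T hq C Fbirat)

/-- **[IUTchI] Ex. 3.2 (vi) (d) DISCHARGED at `ofKits` over an [EtTh] tempered Frobenioid**, both halves: `D_v` is
reconstructible from `F̲_v = C.category` and from `C_v = C^{bs-fld}` (`DFromF`), modulo the [FrdI] Thm. 3.4 (v)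
hypothesis bundles for their self-equivalences ((a) standard type, (b), Frobenioid — print's "[FrdI] Thm. 3.4 (v);
[FrdII] Thm. 1.2 (i)") and the slimness of `D_v = CosetCat Π_v`. [claim: Mochizuki2012, status: disputed] -/
theorem dFromF_ofKits_toInput
    (hF : ∀ e : C.category ≌ C.category, FrdI.Thm34Sub.StdHyp C.toElem C.toElem e)
    (hC : ∀ e : C.hullCategory ≌ C.hullCategory,
      FrdI.Thm34Sub.StdHyp (ModelFrobenioid.toElem C.bsFldMonoid C.cnstFnBsFunctor C.divFNatTrans)
        (ModelFrobenioid.toElem C.bsFldMonoid C.cnstFnBsFunctor C.divFNatTrans) e)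
    (hslim : IsSlim (CosetCat P)) :
    (ofKits l d T q qroot hpow hq R.toInput).DFromF :=
  ⟨fun e => modelFrobenioid_base_reconstructible e (hF e) hslim,
    fun e => modelFrobenioid_base_reconstructible e (hC e) hslim⟩

/-- **The same with the slimness input in the PRINTED form "[SemiAnbd] Ex. 3.10, Rmk. 3.4.1"**: `Π_v` tempered and
slim ⇒ `𝓑^temp(Π_v)⁰` slim (abc-iut-L3's `CosetCat.isSlim_of_isSlimGroup_of_isTempered`).
[claim: Mochizuki2012, status: disputed] -/
theorem dFromF_ofKits_toInput_of_isTempered [IsTopologicalGroup P]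
    (hF : ∀ e : C.category ≌ C.category, FrdI.Thm34Sub.StdHyp C.toElem C.toElem e)
    (hC : ∀ e : C.hullCategory ≌ C.hullCategory,
      FrdI.Thm34Sub.StdHyp (ModelFrobenioid.toElem C.bsFldMonoid C.cnstFnBsFunctor C.divFNatTrans)
        (ModelFrobenioid.toElem C.bsFldMonoid C.cnstFnBsFunctor C.divFNatTrans) e)
    (hG : IsTempered P) (hZ : IsSlimGroup P) :
    (ofKits l d T q qroot hpow hq R.toInput).DFromF :=
  dFromF_ofKits_toInput l d T q qroot hpow hq C R hF hC (CosetCat.isSlim_of_isSlimGroup_of_isTempered hG hZ)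

end BadLocalFrobenioid

end Literature.IUT.HodgeTheaters

end
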